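import Mathlib
import HarnessLib
import Summits.NavierStokesRegularity.NavierStokesRegularity.Theorems.PoloidalWindowDoorPoloidalWindowRigidityVorticityTranslate
import Summits.NavierStokesRegularity.NavierStokesRegularity.Theorems.PoloidalWindowDoorPoloidalWindowRigidityVorticityAxisymmetricAnyAxis
import Summits.NavierStokesRegularity.NavierStokesRegularity.Theorems.IsobarTomographyTubeAlternativeStubDefectAnalyticOfVelocity
import Summits.NavierStokesRegularity.NavierStokesRegularity.Theorems.SymmetricLiouville.Negative.ScrewClause

/-!
# Route `PoloidalWindowDoor`, crux `PoloidalWindowRigidity` (K2, stmt-NavierStokesRegularity-19708) —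
# LOCAL SYMMETRY OF THE VORTICITY ON AN OPEN SET KILLS THE PROFILE (the analytic-continuation half of the K2 lead's
# «LRC′ ⇒ K2»: a one-parameter horizontal isometry group of the vorticity on ONE open space(–time) set suffices)

Cell ns-regularity-ideate, seat ns-poloidal-K2-p3 gen 3 (stub-worker under the K2 lead ns-poloidal-K2-p1 g3; file landed
`--supports stmt-NavierStokesRegularity-19708` as a helper).  The lead's LEAD LINE #1 (3) / K2P1-LOCAL-NOTES v3 §10 conjecture
LRC′ («analytic NS flow, `ω₃ ≡ 0`, `ω ≠ 0`, `Λ ∉ {0,1}` on an open set ⇒ the VORTICITY has a one-parameter horizontal isometry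
group — translations (stratum A) or rotations about a vertical axis (stratum A′)») concludes a LOCAL symmetry; the settled
strata of this seat's base (`…VorticityTranslate`, p451285; `…VorticityAxisymmetricAnyAxis`, p461071) need the symmetry of a
WHOLE slice (resp. of every slice).  This file supplies the bridge — real-analyticity of the class in space and time:
* `curl_translate_of_fderiv_eq_zero_on` — if `D(curl v(s))(y)[e] = 0` on a nonempty open set of ONE slice, then
  `curl v(s)` is invariant under all translations along `e` on that slice (identity theorem for the analytic function
  `y ↦ D(curl v(s))(y)[e]`, then constancy along lines);
* `nonflatLiouville_of_local_curl_translation` — hence (stratum A) the apex is regular; no poloidality needed;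
* `curl_infinitesimal_rotation_of_spacetime_open` — if the Lie derivative of the vorticity along the rotation field about
  the vertical axis through `c` vanishes, `D(curl v(s))(y)[J(y − c)] = J curl v(s)(y)`, on a nonempty open SPACE–TIME set,
  it vanishes on the whole slab (joint analyticity of `(s,y) ↦ curl v(s)(y)`, tree `analyticOnNhd_uncurry_curl`);
* `isAxisymmetric_curl_translate_of_infinitesimal` — integrating the generator (tree `screw_equivariant` with pitch `0`):
  the vorticity of every slice is axisymmetric about the axis `c + ℝe₃`;
* `nonflatLiouville_of_local_curl_rotation` — hence (stratum A′, poloidal profiles) the apex is regular.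
So «LRC′ on some open space–time set of the profile» ⇒ K2's conclusion, by name, for both branches of LRC′.

WHAT THIS IS NOT: not a claim about Navier–Stokes regularity, not LRC′ and not the residue — analytic continuation from an
open set to the slab plus two settled strata (bears_on LADDER-NS N0 via crux K2 = stmt-19708).
-/

noncomputable section

-- the summit and its single sub-problem share the name (CONVENTIONS §1), as in every Theorems file
set_option linter.dupNamespace false

namespace Summit.NavierStokesRegularity.NavierStokesRegularity.Theorems.PoloidalWindowDoorPoloidalWindowRigidityLocalVorticitySymmetry

open Set Function Filter Topology Metric
open scoped RealInnerProductSpace InnerProductSpace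
open Literature.Analysis Literature.Analysis.FluidPDE
open Summit.NavierStokesRegularity.NavierStokesRegularity.Theorems.LocalSineTubeDoorProfileAlignedWindowRigidityAncient
open Summit.NavierStokesRegularity.NavierStokesRegularity.Theorems.TubeAlternative.AnalyticPropagation
open Summit.NavierStokesRegularity.NavierStokesRegularity.Theorems.PoloidalWindowDoorPoloidalWindowRigidityVorticityTranslate
open Summit.NavierStokesRegularity.NavierStokesRegularity.Theorems.PoloidalWindowDoorPoloidalWindowRigidityVorticityAxisymmetricAnyAxis
open Summit.NavierStokesRegularity.NavierStokesRegularity.Theorems.SymmetricLiouville.Negative (screw_equivariant ez)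

variable {C : ℝ} {v : ℝ → EuclideanSpace ℝ (Fin 3) → EuclideanSpace ℝ (Fin 3)}

/-! ### Analyticity of the vorticity of a profile -/

/-- The vorticity slice of a profile of the class is real-analytic on `ℝ³`. -/
theorem analyticOnNhd_curl_slice (hrate : HasTypeITimeDecay C v)
    (hcont : ContinuousOn (uncurry v) (Iio (0 : ℝ) ×ˢ univ))
    (hmild : ∀ s t : ℝ, s < t → t < 0 → ∀ x,
      v t x = UnboundedOperators.heatExtension (v s) (t - s) x - oseenDuhamel 1 s v v t x)
    {s : ℝ} (hs : s < 0) : AnalyticOnNhd ℝ (curl (v s)) univ := by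
  have han : AnalyticOnNhd ℝ (v s) univ := analyticOnNhd_slice hcont (bdd_of_hasTypeITimeDecay hrate) hmild hs
  rw [curl_eq_curlCLM_comp]
  exact curlCLM.comp_analyticOnNhd han.fderiv

/-- The vorticity of a profile of the class is JOINTLY real-analytic on the backward slab `(−∞,0) × ℝ³`. -/
theorem analyticOnNhd_uncurry_curl_class (hrate : HasTypeITimeDecay C v)
    (hcont : ContinuousOn (uncurry v) (Iio (0 : ℝ) ×ˢ univ))
    (hmild : ∀ s t : ℝ, s < t → t < 0 → ∀ x,
      v t x = UnboundedOperators.heatExtension (v s) (t - s) x - oseenDuhamel 1 s v v t x) :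
    AnalyticOnNhd ℝ (uncurry fun s y => curl (v s) y) (Iio (0 : ℝ) ×ˢ univ) :=
  analyticOnNhd_uncurry_curl (analyticOnNhd_uncurry hcont (bdd_of_hasTypeITimeDecay hrate) hmild) isOpen_Iio

/-! ### Local translation symmetry of the vorticity (stratum A) -/

/-- **From an open set to the slice (translations).**  If the directional derivative of the vorticity slice along `e`
vanishes on a nonempty open set, `D(curl v(s))(y)[e] = 0` for `y ∈ U`, then `curl v(s)` is invariant under every
translation along `e`. -/
theorem curl_translate_of_fderiv_eq_zero_on (hrate : HasTypeITimeDecay C v)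
    (hcont : ContinuousOn (uncurry v) (Iio (0 : ℝ) ×ˢ univ))
    (hmild : ∀ s t : ℝ, s < t → t < 0 → ∀ x,
      v t x = UnboundedOperators.heatExtension (v s) (t - s) x - oseenDuhamel 1 s v v t x)
    {s : ℝ} (hs : s < 0) {e : EuclideanSpace ℝ (Fin 3)} {U : Set (EuclideanSpace ℝ (Fin 3))} (hU : IsOpen U)
    (hne : U.Nonempty) (h : ∀ y ∈ U, fderiv ℝ (curl (v s)) y e = 0) :
    ∀ (y : EuclideanSpace ℝ (Fin 3)) (l : ℝ), curl (v s) (y + l • e) = curl (v s) y := by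
  have hanC := analyticOnNhd_curl_slice hrate hcont hmild hs
  have hanD : AnalyticOnNhd ℝ (fderiv ℝ (curl (v s))) univ := hanC.fderiv
  -- the analytic function `g(y) = D(curl v(s))(y)[e]` vanishes on `U`, hence everywhere
  have hang : AnalyticOnNhd ℝ (fun y => fderiv ℝ (curl (v s)) y e) univ :=
    (ContinuousLinearMap.apply ℝ (EuclideanSpace ℝ (Fin 3)) e).comp_analyticOnNhd hanD
  obtain ⟨y₀, hy₀⟩ := hne
  have hev : (fun y => fderiv ℝ (curl (v s)) y e) =ᶠ[𝓝 y₀] 0 := by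
    filter_upwards [hU.mem_nhds hy₀] with y hy
    exact h y hy
  have hg0 : ∀ y, fderiv ℝ (curl (v s)) y e = 0 := fun y =>
    hang.eqOn_zero_of_preconnected_of_eventuallyEq_zero isPreconnected_univ (mem_univ y₀) hev (mem_univ y)
  -- constancy along the lines `l ↦ y + l e`
  have hdiff : Differentiable ℝ (curl (v s)) := fun y => (hanC y (mem_univ y)).differentiableAt
  intro y l
  have hline : ∀ l' : ℝ, HasDerivAt (fun μ : ℝ => curl (v s) (y + μ • e)) (0 : EuclideanSpace ℝ (Fin 3)) l' := by
    intro l'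
    have h1 : HasDerivAt (fun μ : ℝ => y + μ • e) e l' := by
      have := ((hasDerivAt_id l').smul_const e).const_add y
      simpa using this
    have h2 := (hdiff (y + l' • e)).hasFDerivAt.comp_hasDerivAt l' h1
    rw [hg0] at h2
    exact h2
  have hc := is_const_of_deriv_eq_zero (fun l' => (hline l').differentiableAt) (fun l' => (hline l').deriv) l 0
  simpa using hc

/-- **Stratum A from a LOCAL symmetry.**  A profile of the Type-I class whose vorticity has, on SOME nonempty open set of
ONE slice `s < 0`, vanishing derivative along a direction `e ≠ 0` is not backward-singular at the apex (tree
`nonflatLiouville_of_curl_translate_eq_slice` after analytic continuation). -/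
theorem nonflatLiouville_of_local_curl_translation (hrate : HasTypeITimeDecay C v)
    (hcont : ContinuousOn (uncurry v) (Iio (0 : ℝ) ×ˢ univ))
    (hmild : ∀ s t : ℝ, s < t → t < 0 → ∀ x,
      v t x = UnboundedOperators.heatExtension (v s) (t - s) x - oseenDuhamel 1 s v v t x)
    (hdiv : ∀ t < 0, VectorCalculus.IsDivFree (v t)) {s : ℝ} (hs : s < 0) {e : EuclideanSpace ℝ (Fin 3)}
    (he : e ≠ 0) {U : Set (EuclideanSpace ℝ (Fin 3))} (hU : IsOpen U) (hne : U.Nonempty)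
    (h : ∀ y ∈ U, fderiv ℝ (curl (v s)) y e = 0) :
    ¬ IsBackwardSingularPoint v 0 :=
  nonflatLiouville_of_curl_translate_eq_slice hrate hcont hmild hdiv hs he
    (curl_translate_of_fderiv_eq_zero_on hrate hcont hmild hs hU hne h)

/-! ### Local rotational symmetry of the vorticity (stratum A′) -/

/-- **From an open space–time set to the slab (rotations).**  If the Lie derivative of the vorticity along the rotation
field about the vertical axis through `c` vanishes on a nonempty open subset of the backward slab,
`D(curl v(s))(y)[J(y − c)] = J (curl v(s)(y))` for `(s,y) ∈ W`, then it vanishes at every `s < 0`, `y ∈ ℝ³`. -/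
theorem curl_infinitesimal_rotation_of_spacetime_open (hrate : HasTypeITimeDecay C v)
    (hcont : ContinuousOn (uncurry v) (Iio (0 : ℝ) ×ˢ univ))
    (hmild : ∀ s t : ℝ, s < t → t < 0 → ∀ x,
      v t x = UnboundedOperators.heatExtension (v s) (t - s) x - oseenDuhamel 1 s v v t x)
    (c : EuclideanSpace ℝ (Fin 3)) {W : Set (ℝ × EuclideanSpace ℝ (Fin 3))} (hW : IsOpen W) (hWne : W.Nonempty)
    (hWs : W ⊆ Iio (0 : ℝ) ×ˢ univ)
    (h : ∀ z ∈ W, fderiv ℝ (curl (v z.1)) z.2 (rotGen (z.2 - c)) = rotGen (curl (v z.1) z.2)) :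
    ∀ s < 0, ∀ y, fderiv ℝ (curl (v s)) y (rotGen (y - c)) = rotGen (curl (v s) y) := by
  have hanV := analyticOnNhd_uncurry hcont (bdd_of_hasTypeITimeDecay hrate) hmild
  have hanC : AnalyticOnNhd ℝ (uncurry fun s y => curl (v s) y) (Iio (0 : ℝ) ×ˢ univ) :=
    analyticOnNhd_uncurry_curl hanV isOpen_Iio
  -- the generator field `(s, y) ↦ J(y − c)` is jointly analytic (linear in `y`)
  have hanK : AnalyticOnNhd ℝ (uncurry fun (_ : ℝ) (y : EuclideanSpace ℝ (Fin 3)) => rotGen (y - c))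
      (Iio (0 : ℝ) ×ˢ univ) := by
    have e : (uncurry fun (_ : ℝ) (y : EuclideanSpace ℝ (Fin 3)) => rotGen (y - c)) =
        fun z : ℝ × EuclideanSpace ℝ (Fin 3) => rotGenL (z.2 - c) := by
      funext z; show rotGen (z.2 - c) = rotGenL (z.2 - c); rw [rotGenL_apply]
    rw [e]
    intro z _
    exact (rotGenL.analyticAt _).comp ((analyticAt_snd).sub analyticAt_const)
  -- `F(s,y) = D(curl v(s))(y)[J(y−c)] − J curl v(s)(y)` is jointly analytic and vanishes on `W`
  have hanA : AnalyticOnNhd ℝ (uncurry fun s y => fderiv ℝ (curl (v s)) y (rotGen (y - c))) (Iio (0 : ℝ) ×ˢ univ) :=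
    analyticOnNhd_uncurry_fderiv_slice_apply hanC isOpen_Iio hanK
  have hanB : AnalyticOnNhd ℝ (uncurry fun s y => rotGen (curl (v s) y)) (Iio (0 : ℝ) ×ˢ univ) := by
    have e : (uncurry fun s y => rotGen (curl (v s) y)) = rotGenL ∘ (uncurry fun s y => curl (v s) y) := by
      funext z; show rotGen (curl (v z.1) z.2) = rotGenL (curl (v z.1) z.2); rw [rotGenL_apply]
    rw [e]
    exact rotGenL.comp_analyticOnNhd hanC
  have hanF : AnalyticOnNhd ℝ (uncurry fun s y => fderiv ℝ (curl (v s)) y (rotGen (y - c)) - rotGen (curl (v s) y))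
      (Iio (0 : ℝ) ×ˢ univ) := by
    have e : (uncurry fun s y => fderiv ℝ (curl (v s)) y (rotGen (y - c)) - rotGen (curl (v s) y)) =
        (uncurry fun s y => fderiv ℝ (curl (v s)) y (rotGen (y - c))) - uncurry fun s y => rotGen (curl (v s) y) := by
      funext z; rfl
    rw [e]
    exact hanA.sub hanB
  obtain ⟨z₀, hz₀⟩ := hWne
  have hev : (uncurry fun s y => fderiv ℝ (curl (v s)) y (rotGen (y - c)) - rotGen (curl (v s) y)) =ᶠ[𝓝 z₀] 0 := by
    filter_upwards [hW.mem_nhds hz₀] with z hz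
    show fderiv ℝ (curl (v z.1)) z.2 (rotGen (z.2 - c)) - rotGen (curl (v z.1) z.2) = 0
    rw [h z hz, sub_self]
  have hpre : IsPreconnected (Iio (0 : ℝ) ×ˢ (univ : Set (EuclideanSpace ℝ (Fin 3)))) :=
    ((convex_Iio 0).prod convex_univ).isPreconnected
  have hzero := hanF.eqOn_zero_of_preconnected_of_eventuallyEq_zero hpre (hWs hz₀) hev
  intro s hs y
  have := hzero (mk_mem_prod hs (mem_univ y))
  exact sub_eq_zero.1 this

/-- **Integrating the generator.**  If `D(curl v(s))(y)[J(y − c)] = J curl v(s)(y)` for all `y` on an analytic slice,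
then the vorticity of the slice translated to the axis, `curl (y ↦ v(s)(y + c))`, is axisymmetric about the vertical axis
(tree `screw_equivariant` with pitch `0`). -/
theorem isAxisymmetric_curl_translate_of_infinitesimal (hrate : HasTypeITimeDecay C v)
    (hcont : ContinuousOn (uncurry v) (Iio (0 : ℝ) ×ˢ univ))
    (hmild : ∀ s t : ℝ, s < t → t < 0 → ∀ x,
      v t x = UnboundedOperators.heatExtension (v s) (t - s) x - oseenDuhamel 1 s v v t x)
    {s : ℝ} (hs : s < 0) (c : EuclideanSpace ℝ (Fin 3))
    (h : ∀ y, fderiv ℝ (curl (v s)) y (rotGen (y - c)) = rotGen (curl (v s) y)) :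
    IsAxisymmetric (curl (fun y => v s (y + c))) := by
  have hanC := analyticOnNhd_curl_slice hrate hcont hmild hs
  have hdiff : Differentiable ℝ (curl (v s)) := fun y => (hanC y (mem_univ y)).differentiableAt
  -- the translated vorticity `u(y) = curl v(s)(y + c)`
  have hcurl : ∀ y, curl (fun y => v s (y + c)) y = curl (v s) (y + c) := fun y => by
    rw [curl_eq_curlCLM, curl_eq_curlCLM, fderiv_comp_add_right]
  set u : EuclideanSpace ℝ (Fin 3) → EuclideanSpace ℝ (Fin 3) := fun y => curl (v s) (y + c) with hu
  have hud : Differentiable ℝ u := by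
    have e : u = curl (v s) ∘ fun y => y + c := rfl
    rw [e]
    exact hdiff.comp (differentiable_id.add_const c)
  have hcl : ∀ y, fderiv ℝ u y ((0 : ℝ) • ez + rotGen y) = rotGen (u y) := by
    intro y
    rw [zero_smul, zero_add, hu]
    dsimp only
    rw [fderiv_comp_add_right, ← h (y + c), add_sub_cancel_right]
  intro θ y
  have hsc := screw_equivariant hud 0 hcl θ y
  rw [mul_zero, zero_smul, add_zero] at hsc
  show curl (fun y => v s (y + c)) (rotZ θ y) = rotZ θ (curl (fun y => v s (y + c)) y)
  rw [hcurl, hcurl]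
  exact hsc

/-- **Stratum A′ from a LOCAL symmetry.**  A POLOIDAL profile of the Type-I class whose vorticity is infinitesimally
rotation-invariant about some vertical axis `c + ℝe₃` on SOME nonempty open subset of the backward slab,
`D(curl v(s))(y)[J(y − c)] = J curl v(s)(y)` for `(s,y) ∈ W`, is not backward-singular at the apex (tree
`nonflatLiouville_of_curl_axisymmetric_anyAxis` after analytic continuation in space–time and integration of the
generator). -/
theorem nonflatLiouville_of_local_curl_rotation (hrate : HasTypeITimeDecay C v)
    (hcont : ContinuousOn (uncurry v) (Iio (0 : ℝ) ×ˢ univ))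
    (hmild : ∀ s t : ℝ, s < t → t < 0 → ∀ x,
      v t x = UnboundedOperators.heatExtension (v s) (t - s) x - oseenDuhamel 1 s v v t x)
    (hdiv : ∀ t < 0, VectorCalculus.IsDivFree (v t))
    (hpol : ∀ s < 0, ∀ y, ⟪curl (v s) y, EuclideanSpace.single 2 1⟫_ℝ = 0)
    (c : EuclideanSpace ℝ (Fin 3)) {W : Set (ℝ × EuclideanSpace ℝ (Fin 3))} (hW : IsOpen W) (hWne : W.Nonempty)
    (hWs : W ⊆ Iio (0 : ℝ) ×ˢ univ)
    (h : ∀ z ∈ W, fderiv ℝ (curl (v z.1)) z.2 (rotGen (z.2 - c)) = rotGen (curl (v z.1) z.2)) :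
    ¬ IsBackwardSingularPoint v 0 := by
  have hall := curl_infinitesimal_rotation_of_spacetime_open hrate hcont hmild c hW hWne hWs h
  have haxi : ∀ s < 0, IsAxisymmetric (curl (fun y =>
      (LinearIsometryEquiv.refl ℝ (EuclideanSpace ℝ (Fin 3))).symm
        (v s ((LinearIsometryEquiv.refl ℝ (EuclideanSpace ℝ (Fin 3))) y + c)))) := by
    intro s hs
    have e : (fun y => (LinearIsometryEquiv.refl ℝ (EuclideanSpace ℝ (Fin 3))).symm
        (v s ((LinearIsometryEquiv.refl ℝ (EuclideanSpace ℝ (Fin 3))) y + c))) = fun y => v s (y + c) := by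
      funext y; rfl
    rw [e]
    exact isAxisymmetric_curl_translate_of_infinitesimal hrate hcont hmild hs c (hall s hs)
  exact nonflatLiouville_of_curl_axisymmetric_anyAxis hrate hcont hmild hdiv hpol
    (LinearIsometryEquiv.refl ℝ (EuclideanSpace ℝ (Fin 3))) c haxi

end Summit.NavierStokesRegularity.NavierStokesRegularity.Theorems.PoloidalWindowDoorPoloidalWindowRigidityLocalVorticitySymmetry

end
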